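import Literature.NumberTheory.EllipticCurves.Kato2004.HullDescentSkeletonProofs
import HarnessLib

/-!
# Kato 2004, §14.14–14.15 through the reflexive hull, with a general `Λ`-MULTIPLIER: the hull descent
# `v_p(c(0)) + ord_p #(H2/TH2) ≤ ord_p [A : Λ·ι(ȳ)]` for `j(y) = c · z`, `c(0) ≠ 0`
# (companion of `HullDescentSkeletonProofs`, whose `c = p^e` case this generalises; module theory over `ℤ_p⟦T⟧` only)

K. Kato, *`p`-adic Hodge theory and values of zeta functions of modular forms*, Astérisque **295**
(2004) [Kato2004Asterisque]. The integral zeta element that actually enters Kato's `𝐇¹(T)` at the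
lattice `T = V_{O_λ}(f)` (Thm. 12.6, p. 222) is the `(c,d,a(A))`-element
`(_{c,d}z^{(p)}_{p^n}(f,k,j,a(A),prime(pA)))_n`, which by Lemma 13.10 (1) (p. 230) equals
`μ · z_γ^{(p)}` for an explicit MULTIPLIER `μ ∈ Λ` (the Euler factors at the primes of `A` times the
four-cusp combination `c²d² − c d² σ_c − c² d σ_d + c d σ_{cd}` weighted by the coordinates of the
cusp classes `δ(f,j,·(A))^±`), while Kato's normalised `z_γ^{(p)}` lies only in the reflexive hull of
`𝐇¹(T)` (13.14, p. 234). The companion file `HullDescentSkeletonProofs` runs Kato's count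
(14.14.1)–(14.14.2) + Lemma 14.15 for an integral multiple `y = p^e z`; this file runs the SAME count
for `y = c · z` with an arbitrary `c ∈ Λ` of non-zero constant term `c(0)` (the image of `μ` under the
augmentation `Λ → ℤ_p`, `σ ↦ 1`), so that a consumer may carry Kato's multiplier as a datum instead of
choosing `(c, d, a, A)` with `p`-adic unit multiplier:

* `eulerExp_quotient_span_singleton`: `e(Λ/(c)) = v_p(c(0))` for `c(0) ≠ 0` (`#Λ/(c,T) = p^{v_p(c(0))}`,
  `(Λ/(c))[T] = 0`);
* `exists_index_eq_pow_mul_natCard_coinvariants_of_hull_smul`: in the situation of (14.14.1) with the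
  zeta element `z` in the hull `j : H ↪ F` and `j(y) = c · z`,
  `[A : Λ·ι(ȳ)] = p^{v_p(c(0)) + m} · #(H2/TH2)` for some `m ≥ 0`;
* `valuation_add_padicValNat_coinvariants_le_of_hull_smul`: the valuation form
  `v_p(c(0)) + ord_p #(H2/TH2) ≤ ord_p [A : Λ·ι(ȳ)]`.

Seat `bsd-potss-rkm` (cell `bsd-potss`, item stmt-BirchSwinnertonDyer-19196 `ReducibleKatoMember`):
this is the algebra that lets the `𝐇²` package at Kato's member carry the multiplier of the PINNED
zeta class (the `Λ`-adic class of a `ZetaBody` family, `IwasawaH1Data.existsUnique_lift_of_zetaBody`)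
honestly. Nothing about Kato's objects is asserted; no named fact; no instance; no notation.

References: [Kato2004Asterisque] Lemma 13.10 (1) (p. 230), 13.14 (p. 234), Thm. 14.5 and the index
`[M : z]` (pp. 236–237), §14.14 (14.14.1)–(14.14.2) and Lemma 14.15 (pp. 243–244); [GreenbergLNM1716]
§4 Lemma 4.2; [Washington1997] §13.2.
-/

noncomputable section

open scoped Classical

universe u

namespace Literature.NumberTheory.EllipticCurves.Kato2004

open Literature.NumberTheory.EllipticCurves.IwasawaAlgebra

variable {p : ℕ} [Fact p.Prime]

/-! ### §1 The cyclic module `Λ/(c)` for `c(0) ≠ 0`: torsion, `(Λ/(c))[T] = 0`, `e(Λ/(c)) = v_p(c(0))` -/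

/-- `Λ/(c)` is a torsion `Λ`-module for `c ≠ 0` (it is killed by `c`) (private helper). [folklore] -/
private theorem isTorsion_quotient_span_singleton {c : IwasawaAlgebra p} (hc : c ≠ 0) :
    Module.IsTorsion (IwasawaAlgebra p) (IwasawaAlgebra p ⧸ Ideal.span {c}) := by
  intro q
  refine ⟨⟨c, mem_nonZeroDivisors_of_ne_zero hc⟩, ?_⟩
  induction q using Submodule.Quotient.induction_on with
  | H x =>
    rw [Submonoid.smul_def]
    change c • Submodule.Quotient.mk x = 0
    rw [← Submodule.Quotient.mk_smul, Submodule.Quotient.mk_eq_zero, smul_eq_mul]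
    exact Ideal.mul_mem_right _ _ (Ideal.mem_span_singleton_self c)

/-- `(Λ/(c))[T] = 0` when `c(0) ≠ 0`: if `T·x ∈ (c)`, say `T x = c y`, then `y(0) = 0`, so `y = T y'`
and `x = c y'` (`Λ = ℤ_p⟦T⟧` is a domain and `T ∣ φ ↔ φ(0) = 0`) (private helper). [folklore] -/
private theorem invariants_quotient_span_singleton_eq_bot {c : IwasawaAlgebra p}
    (hc0 : PowerSeries.constantCoeff c ≠ 0) :
    invariants p (IwasawaAlgebra p ⧸ Ideal.span {c}) = ⊥ := by
  rw [eq_bot_iff]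
  intro q hq
  rw [Submodule.mem_bot]
  induction q using Submodule.Quotient.induction_on with
  | H x =>
    have hT : (PowerSeries.X : IwasawaAlgebra p) • (Submodule.Quotient.mk x :
        IwasawaAlgebra p ⧸ Ideal.span {c}) = 0 := (mem_invariants_iff p _ _).mp hq
    rw [← Submodule.Quotient.mk_smul, Submodule.Quotient.mk_eq_zero, smul_eq_mul,
      Ideal.mem_span_singleton'] at hT
    obtain ⟨y, hy⟩ := hT
    -- `y(0) = 0`, so `y = T·y'`
    have hy0 : PowerSeries.constantCoeff y = 0 := by
      have h := congrArg PowerSeries.constantCoeff hy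
      rw [map_mul, map_mul, PowerSeries.constantCoeff_X, zero_mul, mul_eq_zero] at h
      exact h.resolve_right hc0
    obtain ⟨y', rfl⟩ := (PowerSeries.X_dvd_iff).mpr hy0
    rw [Submodule.Quotient.mk_eq_zero, Ideal.mem_span_singleton']
    refine ⟨y', mul_left_cancel₀ (PowerSeries.X_ne_zero (R := ℤ_[p])) ?_⟩
    rw [← hy]
    ring

/-- **`e(Λ/(c)) = v_p(c(0))`** for `c ∈ Λ` with non-zero constant term: `#Λ/(c,T) = p^{v_p(c(0))}`
(`natCard_quotient_span_sup_span_X`), `(Λ/(c))[T] = 0`, and the `Γ`-Euler characteristic formula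
`#(N/TN) = #N[T]·p^{e(N)}` (`card_coinvariants_of_lengthAt_eq_zero`).
[cite: GreenbergLNM1716, §4 Lemma 4.2] [cite: Washington1997, §13.2] -/
theorem eulerExp_quotient_span_singleton {c : IwasawaAlgebra p}
    (hc0 : PowerSeries.constantCoeff c ≠ 0) :
    eulerExp p (IwasawaAlgebra p ⧸ Ideal.span {c}) = (PowerSeries.constantCoeff c).valuation := by
  have hc : c ≠ 0 := by
    rintro rfl
    exact hc0 (map_zero _)
  set N := IwasawaAlgebra p ⧸ Ideal.span {c} with hN
  have hNt : Module.IsTorsion (IwasawaAlgebra p) N := isTorsion_quotient_span_singleton hc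
  -- `#(N/TN) = p^{v_p(c(0))}`
  have hcard : Nat.card (coinvariants p N) = p ^ (PowerSeries.constantCoeff c).valuation := by
    rw [Nat.card_congr (coinvariantsQuotientEquiv (p := p) (Ideal.span {c})).toEquiv,
      natCard_quotient_span_sup_span_X c hc0]
  have hfin : Finite (coinvariants p N) := by
    apply Nat.finite_of_card_ne_zero
    rw [hcard]
    exact pow_ne_zero _ (Fact.out : p.Prime).ne_zero
  obtain ⟨-, -, h⟩ := card_coinvariants_of_lengthAt_eq_zero N hNt
    (lengthAt_primeT_eq_zero_of_finite_coinvariants N hNt hfin)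
  rw [invariants_quotient_span_singleton_eq_bot hc0, hcard] at h
  have h1 : Nat.card (⊥ : Submodule (IwasawaAlgebra p) N) = 1 := Nat.card_unique
  rw [h1, one_mul] at h
  exact (Nat.pow_right_injective (Fact.out : p.Prime).two_le h).symm

/-! ### §2 The hull descent with a multiplier -/

section Hull

variable {F H H2 A : Type u} [AddCommGroup F] [Module (IwasawaAlgebra p) F]
  [AddCommGroup H] [Module (IwasawaAlgebra p) H] [AddCommGroup H2] [Module (IwasawaAlgebra p) H2]
  [AddCommGroup A] [Module (IwasawaAlgebra p) A]
  [Module.Finite (IwasawaAlgebra p) F] [NoZeroSMulDivisors (IwasawaAlgebra p) F]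
  [Module.Finite (IwasawaAlgebra p) H] [NoZeroSMulDivisors (IwasawaAlgebra p) H]
  [Module.Finite (IwasawaAlgebra p) H2]

omit [Module.Finite (IwasawaAlgebra p) F] [NoZeroSMulDivisors (IwasawaAlgebra p) F] in
/-- `F/Λ(c·z)` is torsion when `F/Λz` is and `c ≠ 0` (private helper, as in the companion file). [folklore] -/
private theorem isTorsion_quotient_span_smul_of_isTorsion {c : IwasawaAlgebra p} (hc : c ≠ 0) (z : F)
    (hFZ : Module.IsTorsion (IwasawaAlgebra p) (F ⧸ (IwasawaAlgebra p) ∙ z)) :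
    Module.IsTorsion (IwasawaAlgebra p) (F ⧸ (IwasawaAlgebra p) ∙ (c • z)) := by
  intro q
  induction q using Submodule.Quotient.induction_on with
  | H x =>
    obtain ⟨a, ha⟩ := @hFZ (Submodule.Quotient.mk x)
    rw [Submonoid.smul_def, ← Submodule.Quotient.mk_smul, Submodule.Quotient.mk_eq_zero,
      Submodule.mem_span_singleton] at ha
    obtain ⟨b, hb⟩ := ha
    refine ⟨⟨c * (a : IwasawaAlgebra p),
      mul_mem (mem_nonZeroDivisors_of_ne_zero hc) a.2⟩, ?_⟩
    rw [Submonoid.smul_def]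
    change (c * (a : IwasawaAlgebra p)) • Submodule.Quotient.mk x = 0
    rw [← Submodule.Quotient.mk_smul, Submodule.Quotient.mk_eq_zero, Submodule.mem_span_singleton]
    exact ⟨b, by rw [mul_smul, ← hb, smul_comm]⟩

/-- **THE HULL DESCENT WITH A MULTIPLIER (Kato §14.14–14.15 through the reflexive hull; Lemma 13.10 (1)
for the multiplier).** Over `Λ = ℤ_p⟦T⟧`: `F` finitely generated torsion free (`𝐇¹(T)^{**}`), `j : H ↪ F`
of finite index (`H = 𝐇¹(T)`), `z ∈ F` non-zero with `F/Λz` torsion (Kato's `z_γ^{(p)}` in the hull,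
13.14), `H2` finitely generated torsion (`𝐇²(T)`) with `ℓ_𝔮(H2) ≤ ℓ_𝔮(F/Λz)` at every height-one `𝔮`
(the divisibility for the hull), `0 → H/TH →ι A →π H2[T] → 0` exact ((14.14.1)), `H2/TH2` finite
((14.14.2), Thm. 14.5 (1)), and `y ∈ H` with **`j(y) = c·z` for a multiplier `c ∈ Λ` with `c(0) ≠ 0`**
(the integral `(c,d,a(A))`-class, Lemma 13.10 (1)) and `[A : Λ·ι(ȳ)] ≠ 0`. Then
`[A : Λ·ι(ȳ)] = p^{v_p(c(0)) + m} · #(H2/TH2)` for some `m ≥ 0`: `[A : Λ·ι ȳ] = #H2[T]·#((H/Λy)/T)`,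
`#((H/Λy)/T) = p^{e(H/Λy)}`, `e(H/Λy) = e(F/Λ cz) = e(F/Λz) + e(Λ/(c)) = e(F/Λz) + v_p(c(0))`,
`#(H2/TH2) = #H2[T]·p^{e(H2)}`, `e(H2) ≤ e(F/Λz)`. Module theory only; nothing about Kato's objects is
asserted. [cite: Kato2004Asterisque, Lemma 13.10 (1) (p. 230), 13.14 (p. 234), Thm. 14.5 (3) and `[M : z]` (pp. 236–237), §14.14 (14.14.1)–(14.14.2) and Lemma 14.15 (pp. 243–244)] -/
theorem exists_index_eq_pow_mul_natCard_coinvariants_of_hull_smul (j : H →ₗ[IwasawaAlgebra p] F)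
    (hj : Function.Injective j) (hcok : Finite (F ⧸ LinearMap.range j)) (z : F) (hz : z ≠ 0)
    (hFZ : Module.IsTorsion (IwasawaAlgebra p) (F ⧸ (IwasawaAlgebra p) ∙ z))
    (hH2 : Module.IsTorsion (IwasawaAlgebra p) H2)
    (hdiv : ∀ 𝔮 : PrimeSpectrum (IwasawaAlgebra p), 𝔮.asIdeal.height = 1 →
      Module.lengthAt (IwasawaAlgebra p) H2 𝔮 ≤
        Module.lengthAt (IwasawaAlgebra p) (F ⧸ (IwasawaAlgebra p) ∙ z) 𝔮)
    (y : H) (c : IwasawaAlgebra p) (hc0 : PowerSeries.constantCoeff c ≠ 0) (hy : j y = c • z)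
    (ι : coinvariants p H →ₗ[IwasawaAlgebra p] A) (π : A →ₗ[IwasawaAlgebra p] invariants p H2)
    (hι : Function.Injective ι) (hπ : Function.Surjective π) (hex : Function.Exact ι π)
    (hfin : Finite (coinvariants p H2))
    (hne : Nat.card (A ⧸ (IwasawaAlgebra p) ∙ ι (Submodule.Quotient.mk y)) ≠ 0) :
    ∃ m : ℕ, Nat.card (A ⧸ (IwasawaAlgebra p) ∙ ι (Submodule.Quotient.mk y)) =
      p ^ ((PowerSeries.constantCoeff c).valuation + m) * Nat.card (coinvariants p H2) := by
  have hc : c ≠ 0 := by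
    rintro rfl
    exact hc0 (map_zero _)
  -- `y ≠ 0`
  have hy0 : y ≠ 0 := by
    rintro rfl
    rw [map_zero] at hy
    rcases smul_eq_zero.mp hy.symm with h | h
    · exact hc h
    · exact hz h
  -- torsion and Euler exponents of the quotients by the zeta lines
  have hFcz : Module.IsTorsion (IwasawaAlgebra p) (F ⧸ (IwasawaAlgebra p) ∙ (c • z)) :=
    isTorsion_quotient_span_smul_of_isTorsion hc z hFZ
  have hFy : Module.IsTorsion (IwasawaAlgebra p) (F ⧸ (IwasawaAlgebra p) ∙ j y) := by
    rw [hy]; exact hFcz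
  obtain ⟨hHy, heHF⟩ := eulerExp_quotient_span_eq_of_finite_index j hj hcok y hFy
  have heF : eulerExp p (F ⧸ (IwasawaAlgebra p) ∙ j y) =
      eulerExp p (F ⧸ (IwasawaAlgebra p) ∙ z) + (PowerSeries.constantCoeff c).valuation := by
    rw [hy, eulerExp_quotient_span_smul hc z hz hFZ, eulerExp_quotient_span_singleton hc0]
  have hle : eulerExp p H2 ≤ eulerExp p (F ⧸ (IwasawaAlgebra p) ∙ z) :=
    eulerExp_le_of_lengthAt_le hH2 hFZ hdiv
  -- the counts
  set Q := H ⧸ (IwasawaAlgebra p) ∙ y with hQ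
  obtain ⟨-, hcard2⟩ := natCard_coinvariants_eq_of_finite H2 hH2 hfin
  have hA : Nat.card (A ⧸ (IwasawaAlgebra p) ∙ ι (Submodule.Quotient.mk y)) =
      Nat.card (invariants p H2) * Nat.card (coinvariants p Q) := by
    rw [natCard_quotient_eq_of_exact ι π hι hπ hex, ← natCard_coinvariants_quotient_span y]
  have hneQ : Nat.card (coinvariants p Q) ≠ 0 := by
    intro h0
    rw [h0, mul_zero] at hA
    exact hne hA
  have hfinQ : Finite (coinvariants p Q) := Nat.finite_of_card_ne_zero hneQ
  have hTQ : Module.lengthAt (IwasawaAlgebra p) Q (primeT p) = 0 :=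
    lengthAt_primeT_eq_zero_of_finite_coinvariants Q hHy hfinQ
  obtain ⟨hfinQT, -, hcardQ⟩ := card_coinvariants_of_lengthAt_eq_zero Q hHy hTQ
  rw [natCard_invariants_quotient_span_eq_one y hy0 hfinQT, one_mul] at hcardQ
  refine ⟨eulerExp p (F ⧸ (IwasawaAlgebra p) ∙ z) - eulerExp p H2, ?_⟩
  rw [hA, hcardQ, heHF, heF, hcard2]
  have : eulerExp p (F ⧸ (IwasawaAlgebra p) ∙ z) + (PowerSeries.constantCoeff c).valuation =
      eulerExp p H2 + ((PowerSeries.constantCoeff c).valuation +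
        (eulerExp p (F ⧸ (IwasawaAlgebra p) ∙ z) - eulerExp p H2)) := by omega
  rw [this, pow_add]
  ring

/-- **Valuation form of the hull descent with a multiplier: `v_p(c(0)) + ord_p #(H2/TH2) ≤
ord_p [A : Λ·ι(ȳ)]`** — for `y = c·z_γ` (the `(c,d,a(A))`-class, Lemma 13.10 (1)) this is Kato's
`ord_p [A : z_γ] ≥ ord_p #H²(ℤ[1/p],T)` with `[A : z_γ] = [A : y]·|c(0)|_p` (p. 236, `[M : z]`).
[cite: Kato2004Asterisque, Lemma 13.10 (1) (p. 230), Thm. 14.5 (3) and `[M : z]` (pp. 236–237), §14.14 (p. 243)] -/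
theorem valuation_add_padicValNat_coinvariants_le_of_hull_smul (j : H →ₗ[IwasawaAlgebra p] F)
    (hj : Function.Injective j) (hcok : Finite (F ⧸ LinearMap.range j)) (z : F) (hz : z ≠ 0)
    (hFZ : Module.IsTorsion (IwasawaAlgebra p) (F ⧸ (IwasawaAlgebra p) ∙ z))
    (hH2 : Module.IsTorsion (IwasawaAlgebra p) H2)
    (hdiv : ∀ 𝔮 : PrimeSpectrum (IwasawaAlgebra p), 𝔮.asIdeal.height = 1 →
      Module.lengthAt (IwasawaAlgebra p) H2 𝔮 ≤
        Module.lengthAt (IwasawaAlgebra p) (F ⧸ (IwasawaAlgebra p) ∙ z) 𝔮)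
    (y : H) (c : IwasawaAlgebra p) (hc0 : PowerSeries.constantCoeff c ≠ 0) (hy : j y = c • z)
    (ι : coinvariants p H →ₗ[IwasawaAlgebra p] A) (π : A →ₗ[IwasawaAlgebra p] invariants p H2)
    (hι : Function.Injective ι) (hπ : Function.Surjective π) (hex : Function.Exact ι π)
    (hfin : Finite (coinvariants p H2))
    (hne : Nat.card (A ⧸ (IwasawaAlgebra p) ∙ ι (Submodule.Quotient.mk y)) ≠ 0) :
    (PowerSeries.constantCoeff c).valuation + padicValNat p (Nat.card (coinvariants p H2)) ≤
      padicValNat p (Nat.card (A ⧸ (IwasawaAlgebra p) ∙ ι (Submodule.Quotient.mk y))) := by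
  haveI := hfin
  obtain ⟨m, hm⟩ := exists_index_eq_pow_mul_natCard_coinvariants_of_hull_smul j hj hcok z hz hFZ
    hH2 hdiv y c hc0 hy ι π hι hπ hex hfin hne
  have h2 : Nat.card (coinvariants p H2) ≠ 0 := (Nat.card_pos (α := coinvariants p H2)).ne'
  rw [hm, padicValNat.mul (pow_ne_zero _ (Fact.out : p.Prime).ne_zero) h2, padicValNat.prime_pow]
  omega

end Hull

end Literature.NumberTheory.EllipticCurves.Kato2004

end
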